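import Mathlib
import Summits.CriticalPhenomena.Ising3DConformalLimit.Theses.PrimaryAtInfinity
import Summits.CriticalPhenomena.Ising3DConformalLimit.Theorems.PrimaryAtInfinityMultipoleToWardHelpers
import Summits.CriticalPhenomena.Ising3DConformalLimit.Theorems.PrimaryAtInfinityMultipoleToWardRegularity
import Summits.CriticalPhenomena.Ising3DConformalLimit.Theorems.PrimaryAtInfinityMultipoleToWardSides

/-!
# Route PrimaryAtInfinity · support item `MultipoleToWard` (stmt-CriticalPhenomena-5356)

**Theorem (`multipoleToWard_proof`).** The route decl
`Summit.CriticalPhenomena.Ising3DConformalLimit.Theses.PrimaryAtInfinity.MultipoleToWard` holds: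
if every `S n` is continuous on non-coincident configurations, `c ≠ 0`, and for every `n` there
are far-field coefficients `(A₀, A₁)` of `S (n+2)` with the first-order expansion at infinity,
the weak first-multipole identity at level `n + 1`, and the monopole (`o(1/‖z‖)`) / dipole
clustering onto `c · S n`, `2Δc · S n · z`, then every `S n` satisfies the weak special-conformal
Ward identity `∫ S n · 𝒦†_b φ = 0` with weight `Δ`.

Proof (as planned on the route card, with one simplification). Fix `n, b, φ`. Take an EVEN
smooth annular bump `χ` on `ℝ³` (`χ = 0` on the unit ball, `∫ χ > 0`) and test the level-`n+1`
identity with `ψ(x, z) = φ(x) χ(z/L)`, admissible for `L` larger than the support of `φ`. On the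
product, `𝒦†_{n+1} ψ = χ_L 𝒦†_n φ + φ 𝒦†_1 χ_L` (`kward_init_mul_last`). Inserting
`A₀ = c Sₙ + O(ε/‖z‖)`, `A₁ = 2Δc Sₙ z + O(ε)` (clustering, uniform on `tsupport φ` for
`‖z‖ ≥ L`): the two `O(L⁴)` explicit terms `2Δc (∫⟪z,b⟫χ_L)(∫Sₙφ)` and `c (∫𝒦†_1χ_L)(∫Sₙφ)`
both VANISH BY PARITY (`χ_L` even ⇒ both integrands odd; no integration by parts is needed), and
what is left is `c L³ (∫χ) ∫ Sₙ 𝒦†φ = O(ε L³)`. Hence `|c| (∫χ) |∫ Sₙ 𝒦†φ| ≤ ε C` for every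
`ε > 0`, i.e. `∫ Sₙ 𝒦†φ = 0`. The far-field expansion hypothesis is used only to make `A₀` and
`⟪A₁, b⟫` continuous (file `…Regularity`), which makes all integrals honest Bochner integrals.

Sources: Di Francesco–Mathieu–Sénéchal 1997 §4.2–4.3 (special conformal Ward identity,
generator `K_b(x) = ‖x‖² b - 2⟪b,x⟫x`); Hörmander, *ALPDO I*, §1 (test functions). [folklore]
-/

noncomputable section

namespace Summit.CriticalPhenomena.Ising3DConformalLimit.Theorems.PrimaryAtInfinityMultipoleToWard

open MeasureTheory Filter Set Function Metric Literature.Probability.LatticeModels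
open scoped Topology
/-! ### The adjoint special-conformal expression of a tensor test function -/

/-- For `ψ(w) = φ(init w) χ(w last)`: at `w = (x, z)`,
`𝒦†_{n+1} ψ (x, z) = χ(z) 𝒦†_n φ(x) + φ(x) 𝒦†_1 χ(z)` (the weight `Σᵢ ⟪b, wᵢ⟫` and the
vector field `(‖wᵢ‖² b - 2⟪b, wᵢ⟫ wᵢ)ᵢ` both split over the last point). [folklore] -/
theorem kward_init_mul_last {n : ℕ} {φ : (Fin n → EuclideanSpace ℝ (Fin 3)) → ℝ}
    {χ : EuclideanSpace ℝ (Fin 3) → ℝ} (hφ : Differentiable ℝ φ) (hχ : Differentiable ℝ χ)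
    (Δ : ℝ) (b : EuclideanSpace ℝ (Fin 3)) (x : Fin n → EuclideanSpace ℝ (Fin 3))
    (z : EuclideanSpace ℝ (Fin 3)) :
    (2 * Δ - 6) * (∑ i, inner ℝ b ((Fin.snoc x z : Fin (n + 1) → EuclideanSpace ℝ (Fin 3)) i))
        * (φ (Fin.init (Fin.snoc x z : Fin (n + 1) → EuclideanSpace ℝ (Fin 3)))
          * χ ((Fin.snoc x z : Fin (n + 1) → EuclideanSpace ℝ (Fin 3)) (Fin.last n)))
      + fderiv ℝ (fun w : Fin (n + 1) → EuclideanSpace ℝ (Fin 3) =>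
          φ (Fin.init w) * χ (w (Fin.last n))) (Fin.snoc x z)
          (fun i => ‖(Fin.snoc x z : Fin (n + 1) → EuclideanSpace ℝ (Fin 3)) i‖ ^ 2 • b
            - (2 * inner ℝ b ((Fin.snoc x z : Fin (n + 1) → EuclideanSpace ℝ (Fin 3)) i))
              • (Fin.snoc x z : Fin (n + 1) → EuclideanSpace ℝ (Fin 3)) i)
    = χ z * ((2 * Δ - 6) * (∑ i, inner ℝ b (x i)) * φ x
        + fderiv ℝ φ x (fun i => ‖x i‖ ^ 2 • b - (2 * inner ℝ b (x i)) • x i))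
      + φ x * ((2 * Δ - 6) * inner ℝ b z * χ z
        + fderiv ℝ χ z (‖z‖ ^ 2 • b - (2 * inner ℝ b z) • z)) := by
  rw [fderiv_init_mul_last_apply hφ hχ x z]
  have h1 : Fin.init (fun i => ‖(Fin.snoc x z : Fin (n + 1) → EuclideanSpace ℝ (Fin 3)) i‖ ^ 2 • b
      - (2 * inner ℝ b ((Fin.snoc x z : Fin (n + 1) → EuclideanSpace ℝ (Fin 3)) i))
        • (Fin.snoc x z : Fin (n + 1) → EuclideanSpace ℝ (Fin 3)) i)
      = fun i => ‖x i‖ ^ 2 • b - (2 * inner ℝ b (x i)) • x i := by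
    funext j
    simp [Fin.init, Fin.snoc_castSucc]
  rw [h1]
  simp only [Fin.init_snoc, Fin.snoc_last, Fin.snoc_castSucc, Fin.sum_univ_castSucc]
  ring

/-! ### Dilated cut-offs -/

/-- The dilated cut-off `χ_L(z) = χ(z/L)` of an even smooth bump vanishing on the unit ball:
smooth, compactly supported, even, supported in `{L ≤ ‖z‖}`, and its one-point adjoint
special-conformal expression is `L · (𝒦†χ)(z/L)`. [folklore] -/
theorem exists_dilate {χ : EuclideanSpace ℝ (Fin 3) → ℝ}
    (hχs : ContDiff ℝ ((⊤ : ℕ∞) : WithTop ℕ∞) χ) (hχc : HasCompactSupport χ)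
    (hχe : ∀ x, χ (-x) = χ x) (hχ0 : ∀ x, ‖x‖ ≤ 1 → χ x = 0) {L : ℝ} (hL : 0 < L) :
    ∃ χL : EuclideanSpace ℝ (Fin 3) → ℝ, (∀ z, χL z = χ (L⁻¹ • z)) ∧
      ContDiff ℝ ((⊤ : ℕ∞) : WithTop ℕ∞) χL ∧ HasCompactSupport χL ∧ (∀ z, χL (-z) = χL z) ∧
      (tsupport χL ⊆ {z | L ≤ ‖z‖}) ∧
      ∀ (Δ : ℝ) (b z : EuclideanSpace ℝ (Fin 3)),
        (2 * Δ - 6) * inner ℝ b z * χL z + fderiv ℝ χL z (‖z‖ ^ 2 • b - (2 * inner ℝ b z) • z)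
          = L * ((2 * Δ - 6) * inner ℝ b (L⁻¹ • z) * χ (L⁻¹ • z) + fderiv ℝ χ (L⁻¹ • z)
            (‖L⁻¹ • z‖ ^ 2 • b - (2 * inner ℝ b (L⁻¹ • z)) • (L⁻¹ • z))) := by
  refine ⟨fun z => χ (L⁻¹ • z), fun z => rfl, hχs.comp (contDiff_id.const_smul L⁻¹),
    hasCompactSupport_comp_inv_smul hχc hL, fun z => by simp only [smul_neg, hχe], ?_,
    fun Δ b z => kOne_comp_inv_smul Δ b χ hL z⟩
  have h1 : tsupport χ ⊆ {u | 1 ≤ ‖u‖} := by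
    refine closure_minimal (fun u hu => ?_) (isClosed_le continuous_const continuous_norm)
    rw [mem_setOf_eq]
    by_contra h
    exact hu (hχ0 u (le_of_not_ge h))
  simpa using tsupport_comp_inv_smul_subset hL h1

/-! ### Assembly of the analytic argument -/

/-- **Core analytic lemma (unbundled form of `MultipoleToWard` at level `n`).** If `Sₙ` is
continuous on non-coincident configurations, the far-field coefficients `A₀`, `⟪A₁, b⟫` of level
`n + 1` are continuous there and satisfy the weak first-multipole identity, and they cluster onto
`c Sₙ` (monopole, rate `o(1/‖z‖)`) and `2Δc Sₙ z` (dipole), then `Sₙ` satisfies the weak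
special-conformal Ward identity with weight `Δ`. Proof: test the identity with
`φ(x) χ(z/L)` for an even annular bump `χ`; the `O(L)` terms vanish by parity, the rest is
`c L³ (∫χ) ∫ Sₙ 𝒦†φ + O(ε L³)`. [folklore] -/
theorem integral_ward_eq_zero {n : ℕ} {Sn : (Fin n → EuclideanSpace ℝ (Fin 3)) → ℝ}
    {A₀ : (Fin (n + 1) → EuclideanSpace ℝ (Fin 3)) → ℝ}
    {A₁ : (Fin (n + 1) → EuclideanSpace ℝ (Fin 3)) → EuclideanSpace ℝ (Fin 3)} {c Δ : ℝ}
    (hc : c ≠ 0) (hSn : ContinuousOn Sn (NonCoincident 3 n))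
    (hA₀ : ContinuousOn A₀ (NonCoincident 3 (n + 1)))
    (hA₁ : ∀ b : EuclideanSpace ℝ (Fin 3),
      ContinuousOn (fun w => inner ℝ (A₁ w) b) (NonCoincident 3 (n + 1)))
    (hid : ∀ (b : EuclideanSpace ℝ (Fin 3)) (ψ : (Fin (n + 1) → EuclideanSpace ℝ (Fin 3)) → ℝ),
      ContDiff ℝ ((⊤ : ℕ∞) : WithTop ℕ∞) ψ → HasCompactSupport ψ →
      tsupport ψ ⊆ NonCoincident 3 (n + 1) →
      ∫ w, inner ℝ (A₁ w) b * ψ w = ∫ w, A₀ w * ((2 * Δ - 6) * (∑ i, inner ℝ b (w i)) * ψ w +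
        fderiv ℝ ψ w (fun i => ‖w i‖ ^ 2 • b - (2 * inner ℝ b (w i)) • w i)))
    (hmono : TendstoLocallyUniformlyOn
      (fun (z : EuclideanSpace ℝ (Fin 3)) (x : Fin n → EuclideanSpace ℝ (Fin 3)) =>
        ‖z‖ * (A₀ (Fin.snoc x z) - c * Sn x)) 0 (cocompact (EuclideanSpace ℝ (Fin 3)))
      (NonCoincident 3 n))
    (hdip : TendstoLocallyUniformlyOn
      (fun (z : EuclideanSpace ℝ (Fin 3)) (x : Fin n → EuclideanSpace ℝ (Fin 3)) =>
        A₁ (Fin.snoc x z) - (2 * Δ * c * Sn x) • z) 0 (cocompact (EuclideanSpace ℝ (Fin 3)))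
      (NonCoincident 3 n))
    (b : EuclideanSpace ℝ (Fin 3)) {φ : (Fin n → EuclideanSpace ℝ (Fin 3)) → ℝ}
    (hφ : ContDiff ℝ ((⊤ : ℕ∞) : WithTop ℕ∞) φ) (hφc : HasCompactSupport φ)
    (hφs : tsupport φ ⊆ NonCoincident 3 n) :
    ∫ x, Sn x * ((2 * Δ - 6) * (∑ i, inner ℝ b (x i)) * φ x +
      fderiv ℝ φ x (fun i => ‖x i‖ ^ 2 • b - (2 * inner ℝ b (x i)) • x i)) = 0 := by
  -- the Ward expression of `φ` as an opaque function `Kφ`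
  obtain ⟨Kφ, hKφ⟩ : ∃ Kφ : (Fin n → EuclideanSpace ℝ (Fin 3)) → ℝ, ∀ x,
      Kφ x = (2 * Δ - 6) * (∑ i, inner ℝ b (x i)) * φ x +
        fderiv ℝ φ x (fun i => ‖x i‖ ^ 2 • b - (2 * inner ℝ b (x i)) • x i) := ⟨_, fun x => rfl⟩
  simp_rw [← hKφ]
  have hKφ_eq : Kφ = fun x => (2 * Δ - 6) * (∑ i, inner ℝ b (x i)) * φ x +
      fderiv ℝ φ x (fun i => ‖x i‖ ^ 2 • b - (2 * inner ℝ b (x i)) • x i) := funext hKφ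
  have hVc : Continuous fun x : Fin n → EuclideanSpace ℝ (Fin 3) =>
      (fun i => ‖x i‖ ^ 2 • b - (2 * inner ℝ b (x i)) • x i :
        Fin n → EuclideanSpace ℝ (Fin 3)) := by
    refine continuous_pi fun i => Continuous.sub ?_ ?_
    · exact ((continuous_apply i).norm.pow 2).smul continuous_const
    · have h1 : Continuous fun x : Fin n → EuclideanSpace ℝ (Fin 3) => 2 * inner ℝ b (x i) :=
        continuous_const.mul (continuous_const.inner (continuous_apply i))
      exact h1.smul (continuous_apply i)
  have hac : Continuous fun x : Fin n → EuclideanSpace ℝ (Fin 3) =>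
      (2 * Δ - 6) * ∑ i, inner ℝ b (x i) := by
    refine continuous_const.mul (continuous_finsetSum _ fun i _ => ?_)
    exact continuous_const.inner (continuous_apply i)
  have hKc : Continuous Kφ := by rw [hKφ_eq]; exact continuous_firstOrder hφ hac hVc
  have hKs : HasCompactSupport Kφ := by
    rw [hKφ_eq]; exact hasCompactSupport_firstOrder hφc _ _
  have hKt : tsupport Kφ ⊆ tsupport φ := by rw [hKφ_eq]; exact tsupport_firstOrder_subset _ _
  -- an even annular bump `χ` and its one-point Ward expression `Kχ`
  obtain ⟨χ, hχs, hχc, hχe, hχ0, hχI⟩ := exists_even_annular_bump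
  obtain ⟨Kχ, hKχ⟩ : ∃ Kχ : EuclideanSpace ℝ (Fin 3) → ℝ, ∀ u,
      Kχ u = (2 * Δ - 6) * inner ℝ b u * χ u +
        fderiv ℝ χ u (‖u‖ ^ 2 • b - (2 * inner ℝ b u) • u) := ⟨_, fun u => rfl⟩
  have hKχ_eq : Kχ = fun u => (2 * Δ - 6) * inner ℝ b u * χ u +
      fderiv ℝ χ u (‖u‖ ^ 2 • b - (2 * inner ℝ b u) • u) := funext hKχ
  have hV1 : Continuous fun u : EuclideanSpace ℝ (Fin 3) =>
      ‖u‖ ^ 2 • b - (2 * inner ℝ b u) • u := by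
    refine Continuous.sub ((continuous_norm.pow 2).smul continuous_const) ?_
    have h1 : Continuous fun u : EuclideanSpace ℝ (Fin 3) => 2 * inner ℝ b u :=
      continuous_const.mul (continuous_const.inner continuous_id)
    exact h1.smul continuous_id
  have ha1 : Continuous fun u : EuclideanSpace ℝ (Fin 3) => (2 * Δ - 6) * inner ℝ b u :=
    continuous_const.mul (continuous_const.inner continuous_id)
  have hKχc : Continuous Kχ := by rw [hKχ_eq]; exact continuous_firstOrder hχs ha1 hV1
  have hKχs : HasCompactSupport Kχ := by
    rw [hKχ_eq]; exact hasCompactSupport_firstOrder hχc _ _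
  have hKχt : tsupport Kχ ⊆ {u | 1 ≤ ‖u‖} := by
    rw [hKχ_eq]
    refine (tsupport_firstOrder_subset _ _).trans ?_
    refine closure_minimal (fun u hu => ?_) (isClosed_le continuous_const continuous_norm)
    rw [mem_setOf_eq]
    by_contra h
    exact hu (hχ0 u (le_of_not_ge h))
  have hVe : ∀ u : EuclideanSpace ℝ (Fin 3),
      ‖-u‖ ^ 2 • b - (2 * inner ℝ b (-u)) • (-u) = ‖u‖ ^ 2 • b - (2 * inner ℝ b u) • u := by
    intro u
    rw [norm_neg, inner_neg_right, mul_neg, neg_smul_neg]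
  have hKχodd : ∀ u, Kχ (-u) = -Kχ u := by
    intro u
    rw [hKχ, hKχ, hVe, fderiv_neg_of_even hχe, hχe, inner_neg_right,
      FunLike.coe_neg, Pi.neg_apply]
    ring
  have hKχ0 : ∫ u, Kχ u = 0 := integral_eq_zero_of_odd hKχodd
  -- the constants of the estimate
  set I : ℝ := ∫ z, χ z with hI
  set N₁ : ℝ := ∫ z, |χ z| with hN₁
  set N₂ : ℝ := ∫ z, |Kχ z| with hN₂
  set P₁ : ℝ := ∫ x, |φ x| with hP₁
  set P₂ : ℝ := ∫ x, |Kφ x| with hP₂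
  set X : ℝ := ∫ x, Sn x * Kφ x with hX
  have hN₁0 : 0 ≤ N₁ := integral_nonneg fun _ => abs_nonneg _
  have hN₂0 : 0 ≤ N₂ := integral_nonneg fun _ => abs_nonneg _
  have hP₁0 : 0 ≤ P₁ := integral_nonneg fun _ => abs_nonneg _
  have hP₂0 : 0 ≤ P₂ := integral_nonneg fun _ => abs_nonneg _
  -- a bound on the points of the support of `φ`
  obtain ⟨M, hM0, hM⟩ : ∃ M : ℝ, 0 ≤ M ∧ ∀ x ∈ tsupport φ, ∀ i, ‖x i‖ ≤ M := by
    obtain ⟨R, hR⟩ := hφc.isCompact.isBounded.subset_closedBall 0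
    refine ⟨max R 0, le_max_right _ _, fun x hx i => (norm_le_pi_norm x i).trans ?_⟩
    have := hR hx
    rw [mem_closedBall, dist_zero_right] at this
    exact this.trans (le_max_left _ _)
  -- the key estimate: for every `ε > 0`, `|c| I |X| ≤ ε · C`
  have key : ∀ ε : ℝ, 0 < ε →
      |c| * I * |X| ≤ ε * (‖b‖ * (N₁ * P₁) + (N₁ * P₂ + N₂ * P₁)) := by
    intro ε hε
    obtain ⟨R₀, hR₀⟩ := exists_radius_of_tendstoLocallyUniformlyOn hmono hφc.isCompact hφs hε
    obtain ⟨R₁, hR₁⟩ := exists_radius_of_tendstoLocallyUniformlyOn hdip hφc.isCompact hφs hε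
    set L : ℝ := max (max R₀ R₁) (M + 1) with hL
    have hML : M + 1 ≤ L := le_max_right _ _
    have hL1 : 1 ≤ L := by linarith
    have hL0 : 0 < L := by linarith
    have hR₀L : R₀ ≤ L := (le_max_left _ _).trans (le_max_left _ _)
    have hR₁L : R₁ ≤ L := (le_max_right _ _).trans (le_max_left _ _)
    obtain ⟨χL, hχLdef, hχLs, hχLc, hχLe, hχLt, hKL⟩ := exists_dilate hχs hχc hχe hχ0 hL0
    -- `G₁`: the Ward expression of `χL`, namely `L · Kχ(z/L)`
    obtain ⟨G₁, hG₁⟩ : ∃ G₁ : EuclideanSpace ℝ (Fin 3) → ℝ, ∀ z, G₁ z = L * Kχ (L⁻¹ • z) :=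
      ⟨_, fun z => rfl⟩
    have hG₁_eq : G₁ = fun z => L * Kχ (L⁻¹ • z) := funext hG₁
    have hKLG : ∀ z, (2 * Δ - 6) * inner ℝ b z * χL z +
        fderiv ℝ χL z (‖z‖ ^ 2 • b - (2 * inner ℝ b z) • z) = G₁ z := by
      intro z
      rw [hKL, hG₁, hKχ]
    have hG₁c : Continuous G₁ := by
      rw [hG₁_eq]
      exact continuous_const.mul (hKχc.comp (continuous_const_smul L⁻¹))
    have hG₁s : HasCompactSupport G₁ := by
      rw [hG₁_eq]
      exact (hasCompactSupport_comp_inv_smul hKχs hL0).mul_left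
    have hG₁t : tsupport G₁ ⊆ {z | L ≤ ‖z‖} := by
      rw [hG₁_eq]
      refine tsupport_mul_subset_right.trans ?_
      simpa using tsupport_comp_inv_smul_subset hL0 hKχt
    have hG₁0 : ∫ z, G₁ z = 0 := by
      have h := integral_comp_inv_smul_three Kχ hL0.le
      simp_rw [hG₁]
      rw [integral_const_mul, h, hKχ0, mul_zero, mul_zero]
    -- integrals of the dilated functions
    have hχL1 : ∫ z, |χL z| = L ^ 3 * N₁ := by
      have h := integral_comp_inv_smul_three (fun u => |χ u|) hL0.le
      simp only [← hχLdef] at h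
      exact h
    have hχLI : ∫ z, χL z = L ^ 3 * I := by
      have h := integral_comp_inv_smul_three χ hL0.le
      simp only [← hχLdef] at h
      exact h
    have hG₁1 : ∫ z, |G₁ z| = L ^ 4 * N₂ := by
      have h := integral_comp_inv_smul_three (fun u => |Kχ u|) hL0.le
      have h2 : ∀ z, |G₁ z| = L * |Kχ (L⁻¹ • z)| := fun z => by
        rw [hG₁, abs_mul, abs_of_pos hL0]
      simp_rw [h2]
      rw [integral_const_mul, h]
      ring
    -- the test function `ψ(w) = φ(init w) χL(w last)` and the tested identity
    have hψs := contDiff_init_mul_last hφ hχLs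
    obtain ⟨hψc, hψt⟩ := hasCompactSupport_init_mul_last (n := n) hφc hχLc
    have hgood : ∀ z : EuclideanSpace ℝ (Fin 3), L ≤ ‖z‖ → ∀ x ∈ tsupport φ,
        (Fin.snoc x z : Fin (n + 1) → EuclideanSpace ℝ (Fin 3)) ∈ NonCoincident 3 (n + 1) :=
      fun z hz x hx => snoc_mem_nonCoincident (hφs hx) fun i => by linarith [hM x hx i]
    have hψNC : tsupport (fun w : Fin (n + 1) → EuclideanSpace ℝ (Fin 3) =>
        φ (Fin.init w) * χL (w (Fin.last n))) ⊆ NonCoincident 3 (n + 1) := by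
      intro w hw
      obtain ⟨p, hp, rfl⟩ := hψt hw
      exact hgood _ (hχLt hp.1) _ hp.2
    have hId := hid b _ hψs hψc hψNC
    rw [integral_comp_snoc, integral_comp_snoc] at hId
    have hφd : Differentiable ℝ φ := hφ.differentiable (by simp)
    have hχLd : Differentiable ℝ χL := hχLs.differentiable (by simp)
    have hId' : ∫ p : EuclideanSpace ℝ (Fin 3) × (Fin n → EuclideanSpace ℝ (Fin 3)),
          inner ℝ (A₁ (Fin.snoc p.2 p.1)) b * (φ p.2 * χL p.1)
        = ∫ p : EuclideanSpace ℝ (Fin 3) × (Fin n → EuclideanSpace ℝ (Fin 3)),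
          A₀ (Fin.snoc p.2 p.1) * (χL p.1 * Kφ p.2 + φ p.2 * G₁ p.1) := by
      convert hId using 1
      · congr 1
        funext p
        simp only [Fin.init_snoc, Fin.snoc_last]
      · congr 1
        funext p
        rw [kward_init_mul_last hφd hχLd, hKφ, hKLG]
    -- the two sides
    have hD := dipole_side_bound hSn (hA₁ b) hφ.continuous hφc hφs hχLs.continuous hχLc hχLe
      hχLt hgood (fun z hz x hx => hR₁ z (hR₁L.trans hz) x hx)
    have hMo := monopole_side_bound hSn hA₀ hφ.continuous hφc hφs hKc hKs hKt hχLs.continuous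
      hχLc hχLt hG₁c hG₁s hG₁t hG₁0 hgood hL0 hε.le
      (fun z hz x hx => hR₀ z (hR₀L.trans hz) x hx)
    rw [hId', hχL1] at hD
    rw [hχL1, hχLI, hG₁1] at hMo
    -- arithmetic
    set T : ℝ := ∫ p : EuclideanSpace ℝ (Fin 3) × (Fin n → EuclideanSpace ℝ (Fin 3)),
      A₀ (Fin.snoc p.2 p.1) * (χL p.1 * Kφ p.2 + φ p.2 * G₁ p.1) with hT
    have h3 : |c * (L ^ 3 * I) * X|
        ≤ ε * ‖b‖ * (L ^ 3 * N₁ * P₁) + ε / L * (L ^ 3 * N₁ * P₂ + L ^ 4 * N₂ * P₁) := by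
      have h1 : |c * (L ^ 3 * I) * X| - |T| ≤ |T - c * (L ^ 3 * I) * X| := by
        rw [abs_sub_comm]; exact abs_sub_abs_le_abs_sub _ _
      linarith
    have hL3 : 0 < L ^ 3 := by positivity
    have h4 : |c * (L ^ 3 * I) * X| = L ^ 3 * (|c| * I * |X|) := by
      rw [abs_mul, abs_mul, abs_mul, abs_of_pos hL3, abs_of_pos hχI]
      ring
    have h5 : ε * ‖b‖ * (L ^ 3 * N₁ * P₁) + ε / L * (L ^ 3 * N₁ * P₂ + L ^ 4 * N₂ * P₁)
        = L ^ 3 * (ε * (‖b‖ * (N₁ * P₁) + (N₁ * P₂ / L + N₂ * P₁))) := by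
      field_simp
    have h6 : N₁ * P₂ / L ≤ N₁ * P₂ := div_le_self (by positivity) hL1
    rw [h4, h5] at h3
    have h7 := le_of_mul_le_mul_left h3 hL3
    calc |c| * I * |X| ≤ ε * (‖b‖ * (N₁ * P₁) + (N₁ * P₂ / L + N₂ * P₁)) := h7
      _ ≤ ε * (‖b‖ * (N₁ * P₁) + (N₁ * P₂ + N₂ * P₁)) := by gcongr
  -- conclusion: `|c| I |X| ≤ 0`, hence `X = 0`
  have hC0 : 0 ≤ ‖b‖ * (N₁ * P₁) + (N₁ * P₂ + N₂ * P₁) := by positivity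
  have hle : |c| * I * |X| ≤ 0 := by
    apply le_of_forall_pos_le_add
    intro ε hε
    have h1 := key (ε / (‖b‖ * (N₁ * P₁) + (N₁ * P₂ + N₂ * P₁) + 1)) (by positivity)
    rw [zero_add]
    refine h1.trans ?_
    rw [div_mul_eq_mul_div, div_le_iff₀ (by positivity)]
    nlinarith
  have hpos : 0 < |c| * I := mul_pos (abs_pos.2 hc) hχI
  have hX0 : |X| ≤ 0 := by
    by_contra h
    have h' : 0 < |X| := lt_of_not_ge h
    linarith [mul_pos hpos h']
  exact abs_nonpos_iff.1 hX0

end Summit.CriticalPhenomena.Ising3DConformalLimit.Theorems.PrimaryAtInfinityMultipoleToWard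

namespace Summit.CriticalPhenomena.Ising3DConformalLimit.Theorems

open MeasureTheory Filter Set Function Metric Literature.Probability.LatticeModels
  PrimaryAtInfinityMultipoleToWard

/-- **`MultipoleToWard` (route PrimaryAtInfinity, support item stmt-CriticalPhenomena-5356).**
For a family `S : CorrFamily 3` continuous on non-coincident configurations and `c ≠ 0`: if for
every `n` the far-field coefficients `(A₀, A₁)` of `S (n+2)` exist (first-order expansion at
infinity, locally uniformly), satisfy the weak first-multipole identity at level `n + 1`, and
cluster onto `c · S n` (monopole, rate `o(1/‖z‖)`) and `2Δc · S n · z` (dipole), then every `S n`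
satisfies the weak special-conformal Ward identity with weight `Δ`. The far-field expansion is
used only to make `A₀` and `⟪A₁, b⟫` continuous (`continuousOn_monopole`,
`continuousOn_dipole_inner`); the rest is `integral_ward_eq_zero`. [folklore] -/
theorem multipoleToWard_proof :
    Summit.CriticalPhenomena.Ising3DConformalLimit.Theses.PrimaryAtInfinity.MultipoleToWard := by
  unfold Summit.CriticalPhenomena.Ising3DConformalLimit.Theses.PrimaryAtInfinity.MultipoleToWard
  intro S c Δ hc hcont hH n b φ hφ hφc hφs
  obtain ⟨A₀, A₁, hexp, hid, hmono, hdip⟩ := hH n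
  exact integral_ward_eq_zero hc (hcont n) (continuousOn_monopole (hcont (n + 2)) hexp)
    (continuousOn_dipole_inner (hcont (n + 2)) hexp) hid hmono hdip b hφ hφc hφs

end Summit.CriticalPhenomena.Ising3DConformalLimit.Theorems

end
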